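import Summits.Ventures.Crystal3D.Theorems.StickyWulffConstantTextureLiminfLineCountGlueOneSidedUpTop
import HarnessLib

/-!
# A steep upper slot forces the presenting frame to be up-oriented: `⟪L v, e⟫ > 1/√3 ⇒ (L⁻¹ e)₂ > 0`
# (lane T, crux `TextureLiminfV5`, stmt-Ventures-23912; open item (i) of HANDOFF «wulff-p2 gen 17 FINAL», (δ)-fcc chain of cf-p1 (cii′))

HONEST FRAMING. Venture `Summits/Ventures/Crystal3D` (cell `crystal3d-full`), route `route-Ventures-StickyWulffConstant`, helper
`--supports` the law-v5 crux `TextureLiminfV5` (stmt-Ventures-23912).  Elementary Euclidean geometry plus two compositions by name;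
standard axioms; nothing about any wall law is claimed beyond the stated implications; rung F-C1 not moved.

WHY.  The chosen-slot K1a cells `bilayerWallAt_of_K1a_at` / `bilayerWallAt_of_K1a_top_at` (p693671 / p694292) carry an orientation
hypothesis `hax : 0 ≤ (L⁻¹ e)₂` (`e = e₃` resp. `−e₃`) next to the steepness hypothesis `√2/2 ≤ ⟪L v, e⟫` on an UPPER slot `v`
(`v ∈ fccSlots`, `v₂ = √(2/3)`).  The first is implied by the second: the in-plane part of `v` has length `1/√3`, so if `(L⁻¹e)₂ ≤ 0` then
`⟪L v, e⟫ = ⟪v, L⁻¹e⟫ ≤ 1/√3 < √2/2`.  Hence in the (δ)-fcc chain «`∃ w ∈ fccSlots, 13√2/25 ≤ ⟪A w, e₃⟫` → `exists_fcc_presentation_steep`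
→ `bilayerWallAt_of_K1a_at` → `bilayerWallAt_of_represented₁`» the re-presented frame `L′` needs NO separate orientation check.

CONTENTS.
* `apply_two_pos_of_upper_inner_gt` — unit vectors `u, v` with `v₂ = √(2/3)` and `⟪v, u⟫ > √3/3` have `u₂ > 0` (planar Cauchy–Schwarz).
* `symm_apply_two_pos_of_steep` — for a linear isometry `L`, a unit vector `e` and an upper slot `v`: `√3/3 < ⟪L v, e⟫ ⇒ 0 < (L⁻¹ e)₂`.
* `axis_nonneg_of_upSlot_steep` / `axis_nonneg_of_upSlot_steep_top` — the `e₃` / `−e₃` instances at the K1a threshold `√2/2` (conclusion `0 ≤ …`).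
* `bilayerWallAt_of_K1a_at_steep` / `bilayerWallAt_of_K1a_top_at_steep` — p693671 / p694292 with the hypothesis `hax` DISCHARGED.
WHAT THIS IS NOT: no proof of any wall law or of any registered stub; F-C1 not moved.
-/

noncomputable section

namespace Summit.Ventures.Crystal3D.Theorems

open MeasureTheory Set
open scoped ENNReal InnerProductSpace
open Literature.MathematicalPhysics.StatisticalMechanics (IsHaggSeq fccStacking)
open Summit.Ventures.Crystal3D.Cruxes.TextureLiminf.TexShadow (E3 e₃ bilayerRise BilayerWallAt)

/-! ## The planar inequality -/

/-- **Planar Cauchy–Schwarz.**  If `u, v` are unit vectors of `ℝ³`, `v₂ = √(2/3)` (so the horizontal part of `v` has length `1/√3`) and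
`⟪v, u⟫ > √3/3 = 1/√3`, then `u₂ > 0`: otherwise `⟪v, u⟫ = v₀u₀ + v₁u₁ + v₂u₂ ≤ v₀u₀ + v₁u₁ ≤ (1/√3)·1`. -/
theorem apply_two_pos_of_upper_inner_gt {u v : E3} (hu : ‖u‖ = 1) (hv : ‖v‖ = 1) (hv2 : v 2 = Real.sqrt (2 / 3))
    (h : Real.sqrt 3 / 3 < ⟪v, u⟫_ℝ) : 0 < u 2 := by
  have hus : u 0 ^ 2 + u 1 ^ 2 + u 2 ^ 2 = 1 := by
    have h' := EuclideanSpace.real_norm_sq_eq u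
    rw [hu, Fin.sum_univ_three] at h'
    linarith
  have hvs : v 0 ^ 2 + v 1 ^ 2 + v 2 ^ 2 = 1 := by
    have h' := EuclideanSpace.real_norm_sq_eq v
    rw [hv, Fin.sum_univ_three] at h'
    linarith
  have hinner : ⟪v, u⟫_ℝ = v 0 * u 0 + v 1 * u 1 + v 2 * u 2 := by
    simp only [PiLp.inner_apply, RCLike.inner_apply, conj_trivial, Fin.sum_univ_three]
    ring
  have h23 : v 2 ^ 2 = 2 / 3 := by
    rw [hv2, Real.sq_sqrt (by norm_num)]
  have hv01 : v 0 ^ 2 + v 1 ^ 2 = 1 / 3 := by linarith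
  have h3 : Real.sqrt 3 ^ 2 = 3 := Real.sq_sqrt (by norm_num)
  have hs3 : 0 < Real.sqrt 3 := Real.sqrt_pos.mpr (by norm_num)
  have hv2pos : 0 < v 2 := by rw [hv2]; exact Real.sqrt_pos.mpr (by norm_num)
  by_contra hle
  push Not at hle
  -- the vertical term is nonpositive, the horizontal term is at most `1/√3`
  have hvert : v 2 * u 2 ≤ 0 := mul_nonpos_of_nonneg_of_nonpos hv2pos.le hle
  have hsq : (v 0 * u 0 + v 1 * u 1) ^ 2 ≤ 1 / 3 := by
    nlinarith [sq_nonneg (v 0 * u 1 - v 1 * u 0), sq_nonneg (u 2), hv01, hus]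
  have ht : v 0 * u 0 + v 1 * u 1 ≤ Real.sqrt 3 / 3 := by
    nlinarith [hsq, h3, hs3, sq_nonneg (3 * (v 0 * u 0 + v 1 * u 1) - Real.sqrt 3)]
  rw [hinner] at h
  linarith

/-! ## The frame version -/

/-- **A steep upper slot forces up-orientation.**  For a linear isometry `L`, a unit vector `e` and an upper slot `v ∈ fccSlots`,
`v₂ = √(2/3)`: if `⟪L v, e⟫ > √3/3` then `(L⁻¹ e)₂ > 0` (apply the planar inequality to `u = L⁻¹ e`, using `⟪L v, e⟫ = ⟪v, L⁻¹ e⟫`). -/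
theorem symm_apply_two_pos_of_steep (L : E3 ≃ₗᵢ[ℝ] E3) {e v : E3} (he : ‖e‖ = 1) (hv : v ∈ fccSlots)
    (hv2 : v 2 = Real.sqrt (2 / 3)) (h : Real.sqrt 3 / 3 < ⟪L v, e⟫_ℝ) : 0 < (L.symm e) 2 := by
  have hu : ‖L.symm e‖ = 1 := by rw [LinearIsometryEquiv.norm_map, he]
  have hinner : ⟪L v, e⟫_ℝ = ⟪v, L.symm e⟫_ℝ := by
    conv_lhs => rw [← L.apply_symm_apply e]
    rw [LinearIsometryEquiv.inner_map_map]
  exact apply_two_pos_of_upper_inner_gt hu (norm_eq_one_of_mem_fccSlots hv) hv2 (hinner ▸ h)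

/-- `√3/3 < √2/2` (numerically `0.577 < 0.707`). -/
theorem sqrt_three_div_three_lt_sqrt_two_div_two : Real.sqrt 3 / 3 < Real.sqrt 2 / 2 := by
  have h3 : Real.sqrt 3 ^ 2 = 3 := Real.sq_sqrt (by norm_num)
  have h2 : Real.sqrt 2 ^ 2 = 2 := Real.sq_sqrt (by norm_num)
  have hs3 : 0 < Real.sqrt 3 := Real.sqrt_pos.mpr (by norm_num)
  have hs2 : 0 < Real.sqrt 2 := Real.sqrt_pos.mpr (by norm_num)
  nlinarith [sq_nonneg (2 * Real.sqrt 3 - 3 * Real.sqrt 2), h3, h2, hs3, hs2]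

/-- **`axis_nonneg_of_upSlot_steep` (steering `e₃`).**  An upper slot `v ∈ fccSlots`, `v₂ = √(2/3)`, rising `⟪L v, e₃⟫ ≥ √2/2` forces
`0 ≤ (L⁻¹ e₃)₂` — the orientation hypothesis `hax₁` of `bilayerWallAt_of_K1a_at`. -/
theorem axis_nonneg_of_upSlot_steep (L : E3 ≃ₗᵢ[ℝ] E3) {v : E3} (hv : v ∈ fccSlots) (hv2 : v 2 = Real.sqrt (2 / 3))
    (hsteep : Real.sqrt 2 / 2 ≤ ⟪L v, e₃⟫_ℝ) : 0 ≤ (L.symm e₃) 2 := by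
  have he₃ : ‖(e₃ : E3)‖ = 1 := by rw [e₃, PiLp.norm_single, norm_one]
  exact (symm_apply_two_pos_of_steep L he₃ hv hv2 (sqrt_three_div_three_lt_sqrt_two_div_two.trans_le hsteep)).le

/-- **`axis_nonneg_of_upSlot_steep_top` (steering `−e₃`).**  An upper slot `v ∈ fccSlots`, `v₂ = √(2/3)`, rising `⟪L v, −e₃⟫ ≥ √2/2`
forces `0 ≤ (L⁻¹ (−e₃))₂` — the orientation hypothesis `hax₂` of `bilayerWallAt_of_K1a_top_at`. -/
theorem axis_nonneg_of_upSlot_steep_top (L : E3 ≃ₗᵢ[ℝ] E3) {v : E3} (hv : v ∈ fccSlots) (hv2 : v 2 = Real.sqrt (2 / 3))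
    (hsteep : Real.sqrt 2 / 2 ≤ ⟪L v, -e₃⟫_ℝ) : 0 ≤ (L.symm (-e₃)) 2 := by
  have he₃ : ‖(e₃ : E3)‖ = 1 := by rw [e₃, PiLp.norm_single, norm_one]
  have hne₃ : ‖(-e₃ : E3)‖ = 1 := by rw [norm_neg, he₃]
  exact (symm_apply_two_pos_of_steep L hne₃ hv hv2 (sqrt_three_div_three_lt_sqrt_two_div_two.trans_le hsteep)).le

/-! ## The K1a chosen-slot cells without the orientation hypothesis -/

/-- **`bilayerWallAt_of_K1a_at` with `hax₁` discharged.**  Same statement as p693671's `bilayerWallAt_of_K1a_at` (lane G's E1 and star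
facts; plate 1 presented by `L₁` with a Δ-slot `v ∈ fccSlots`, `v₂ = √(2/3)`, rising `⟪L₁ v, e₃⟫ ≥ √2/2`; clause (ii) of `FramesApart` for
`chainFrames e₃ L₁ v`; `R₀ ≥ 6`; a nonnegative table dominated by half the chosen flux) MINUS the hypothesis `0 ≤ (L₁⁻¹ e₃)₂`, which
follows from the steepness (`axis_nonneg_of_upSlot_steep`). -/
theorem bilayerWallAt_of_K1a_at_steep {sE : E3} (hsE : sE ∈ fccSlots) (hcert : ExactOnly 0 (fccSlots.filter fun w => 0 < ⟪w, sE⟫_ℝ))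
    (hDS : ∀ F₁ F₂ : E3 ≃ₗᵢ[ℝ] E3, DoubleStarCoaxialAt F₁ F₂) (hCP : CapPairCoaxial)
    {σ₁ σ₂ : ℤ → ℤ} (hσ₁ : IsHaggSeq σ₁) (hσ₂ : IsHaggSeq σ₂) (L₁ L₂ : E3 ≃ₗᵢ[ℝ] E3) (s₁ s₂ : E3)
    {v : E3} (hv : v ∈ fccSlots) (hv2 : v 2 = Real.sqrt (2 / 3))
    (hsteep₁ : Real.sqrt 2 / 2 ≤ ⟪L₁ v, e₃⟫_ℝ)
    (hapart₁ : ∀ F ∈ chainFrames e₃ L₁ v,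
      F '' fccStacking 1 (Real.sqrt (2 / 3)) ≠ L₂ '' fccStacking 1 (Real.sqrt (2 / 3)) ∧
      F '' fccStacking 1 (Real.sqrt (2 / 3)) ≠ (twinFrame L₂ (L₂ e₃)) '' fccStacking 1 (Real.sqrt (2 / 3)))
    (R₀ : ℝ) (hR₀ : 6 ≤ R₀) (c : ℤ → ℤ → ℝ) (hc0 : ∀ i j, 0 ≤ c i j)
    (hdom : ∀ i j, c i j ≤ Real.sqrt 2 * (if σ₁ i = 1 then ⟪L₁ v, e₃⟫_ℝ else bilayerRise L₁ σ₁ e₃ i) / 2) :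
    BilayerWallAt ((318 + 192 * R₀ + 80 * (R₀ + 9) + 3456 + 1152 * (R₀ + 1)) / 2) R₀ σ₁ σ₂ L₁ L₂ s₁ s₂ c :=
  bilayerWallAt_of_K1a_at hsE hcert hDS hCP hσ₁ hσ₂ L₁ L₂ s₁ s₂ (axis_nonneg_of_upSlot_steep L₁ hv hv2 hsteep₁) hv hv2 hsteep₁
    hapart₁ R₀ hR₀ c hc0 hdom

/-- **`bilayerWallAt_of_K1a_top_at` with `hax₂` discharged.**  Same statement as p694292's `bilayerWallAt_of_K1a_top_at` (plate 2 presented by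
`L₂` toward `−e₃` with a Δ-slot `v ∈ fccSlots`, `v₂ = √(2/3)`, rising `⟪L₂ v, −e₃⟫ ≥ √2/2`; clause (ii) of `FramesApart` for `chainFrames (−e₃) L₂ v`
against plate 1's frame and its twin; `R₀ ≥ 6`; a nonnegative table dominated by half the chosen flux of plate 2) MINUS the hypothesis
`0 ≤ (L₂⁻¹(−e₃))₂`, which follows from the steepness (`axis_nonneg_of_upSlot_steep_top`). -/
theorem bilayerWallAt_of_K1a_top_at_steep {sE : E3} (hsE : sE ∈ fccSlots) (hcert : ExactOnly 0 (fccSlots.filter fun w => 0 < ⟪w, sE⟫_ℝ))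
    (hDS : ∀ F₁ F₂ : E3 ≃ₗᵢ[ℝ] E3, DoubleStarCoaxialAt F₁ F₂) (hCP : CapPairCoaxial)
    {σ₁ σ₂ : ℤ → ℤ} (hσ₁ : IsHaggSeq σ₁) (hσ₂ : IsHaggSeq σ₂) (L₁ L₂ : E3 ≃ₗᵢ[ℝ] E3) (s₁ s₂ : E3)
    {v : E3} (hv : v ∈ fccSlots) (hv2 : v 2 = Real.sqrt (2 / 3))
    (hsteep₂ : Real.sqrt 2 / 2 ≤ ⟪L₂ v, -e₃⟫_ℝ)
    (hapart₂ : ∀ F ∈ chainFrames (-e₃) L₂ v,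
      F '' fccStacking 1 (Real.sqrt (2 / 3)) ≠ L₁ '' fccStacking 1 (Real.sqrt (2 / 3)) ∧
      F '' fccStacking 1 (Real.sqrt (2 / 3)) ≠ (twinFrame L₁ (L₁ e₃)) '' fccStacking 1 (Real.sqrt (2 / 3)))
    (R₀ : ℝ) (hR₀ : 6 ≤ R₀) (c : ℤ → ℤ → ℝ) (hc0 : ∀ i j, 0 ≤ c i j)
    (hdom : ∀ i j, c i j ≤ Real.sqrt 2 * (if σ₂ j = 1 then ⟪L₂ v, -e₃⟫_ℝ else bilayerRise L₂ σ₂ (-e₃) j) / 2) :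
    BilayerWallAt ((318 + 192 * R₀ + 80 * (R₀ + 9) + 3456 + 1152 * (R₀ + 1)) / 2) R₀ σ₁ σ₂ L₁ L₂ s₁ s₂ c :=
  bilayerWallAt_of_K1a_top_at hsE hcert hDS hCP hσ₁ hσ₂ L₁ L₂ s₁ s₂ (axis_nonneg_of_upSlot_steep_top L₂ hv hv2 hsteep₂) hv hv2
    hsteep₂ hapart₂ R₀ hR₀ c hc0 hdom

end Summit.Ventures.Crystal3D.Theorems
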